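import Summits.HodgeConjecture.CorCM.GaloisCyclicSemidirectEightNormPairCoefficients
import Summits.HodgeConjecture.CorCM.GaloisQuaternionCyclicPrimeOddOrder
import HarnessLib

/-!
# No `μ₄`-norm pair of `Q₈ × C_p` in `ℤ/p` when `ord_p 2` is odd — the purely combinatorial statement

COR-CM (cell `pub-hodgecm2`), binder seat b04 (gen 29), count-neutral claim QUATERNION-CYCLIC-PRIME-DEGENERATE, part VI.
KERNEL ONLY: theorems; no definition, no named fact, no `sorry`.  `HC_CM` is neither used nor claimed.

Part V (`CorCM/GaloisQuaternionCyclicPrimeNormPairIff`) reads part III backwards given a CM field; here the field is removed: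
* `det_eq_zero_of_normPair`: the two balance identities of part II give back `G₀(β)G₀^τ(β) + G₁(β)G₁^τ(β) = 0` at every
  PRIMITIVE `p`-th root of unity `β` (`Gⱼ^τ(β) = Σ_v i^{−kⱼ(v)} β^v`);
* **`forall_normPair_const_of_odd_orderOf_two'`**: for `ord_p 2` odd, part III's obstruction («`−1` is not a sum of two
  squares in `ℚ(ζ_p)`», `exists_subfield_of_odd_orderOf_two`) and part I's `sums_eq_zero_of_det_eq_zero` force `G₀(ζ) = 0`,
  hence `k₀` constant (`GaloisCyclicSemidirectEight.const_of_sheet_sum_eq_zero`).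
So `Q₈ × C_p` is GOOD for `ord_p 2` odd BECAUSE `ℤ/p` has no norm pair of `Q₈ × C_p`, and otherwise GOOD iff it has none
(open for `ord_p 2` even, `p ∉ {3, 5, 11, 13, 17, 19, 37, 43, 61, …}`).

## References

* [Kubota1965] T. Kubota, *On the field extension by complex multiplication*, Trans. AMS 118 (1965), §4 Lemma 2.
* [FeinGordonSmith1971] B. Fein, B. Gordon, J. H. Smith, *On the representation of −1 as a sum of two squares in an
  algebraic number field*, J. Number Theory 3 (1971), 310–315.
* [Washington1997] L. C. Washington, *Introduction to Cyclotomic Fields*, 2nd ed., GTM 83, Thm. 2.5.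
-/

noncomputable section

open scoped BigOperators

namespace Summit.HodgeConjecture.CorCM.GaloisQuaternionCyclic

open Summit.HodgeConjecture.CorCM.GaloisCyclicSemidirectEight (alpha_mul_self alpha_pow_four sum_psi_eq_coord
  const_of_sheet_sum_eq_zero sheet_mul_sheet_tau)
open AddChar
open Multiplicative (ofAdd toAdd)

section Arithmetic

variable {p : ℕ} [Fact p.Prime]

/-- **From the balance identities back to the norm identity (Q₈ × C_p)**: a `μ₄`-norm pair `(k₀, k₁)` of `Q₈ × C_p` satisfies
`G₀(β)G₀^τ(β) + G₁(β)G₁^τ(β) = 0` at every PRIMITIVE `p`-th root of unity `β` (`Gⱼ^τ(β) = Σ_v i^{−kⱼ(v)} β^v`; part II proved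
this inside `exists_simple_degenerate_of_normPair`). [cite: Kubota1965, §4 Lemma 2] -/
theorem det_eq_zero_of_normPair (hI4 : Complex.I ^ (2 * 2) = 1) (k₀ k₁ : ZMod p → ZMod (2 * 2)) {β : ℂ}
    (hβ : IsPrimitiveRoot β p)
    (hR : ∀ d : ZMod p,
      (Finset.univ.filter fun v => k₀ v - k₀ (d - v) = 0).card +
            (Finset.univ.filter fun v => k₁ v - k₁ (d - v) = 0).card +
          (Finset.univ.filter fun v => k₀ v - k₀ (0 - v) = 2).card + (Finset.univ.filter fun v => k₁ v - k₁ (0 - v) = 2).card =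
        (Finset.univ.filter fun v => k₀ v - k₀ (0 - v) = 0).card + (Finset.univ.filter fun v => k₁ v - k₁ (0 - v) = 0).card +
            (Finset.univ.filter fun v => k₀ v - k₀ (d - v) = 2).card +
          (Finset.univ.filter fun v => k₁ v - k₁ (d - v) = 2).card)
    (hI : ∀ d : ZMod p,
      (Finset.univ.filter fun v => k₀ v - k₀ (d - v) = 1).card +
            (Finset.univ.filter fun v => k₁ v - k₁ (d - v) = 1).card +
          (Finset.univ.filter fun v => k₀ v - k₀ (0 - v) = 3).card + (Finset.univ.filter fun v => k₁ v - k₁ (0 - v) = 3).card =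
        (Finset.univ.filter fun v => k₀ v - k₀ (0 - v) = 1).card + (Finset.univ.filter fun v => k₁ v - k₁ (0 - v) = 1).card +
            (Finset.univ.filter fun v => k₀ v - k₀ (d - v) = 3).card +
          (Finset.univ.filter fun v => k₁ v - k₁ (d - v) = 3).card) :
    (∑ v : ZMod p, zmodChar (2 * 2) hI4 (k₀ v) * zmodChar p hβ.pow_eq_one v) *
        (∑ v : ZMod p, zmodChar (2 * 2) hI4 (-k₀ v) * zmodChar p hβ.pow_eq_one v) +
      (∑ v : ZMod p, zmodChar (2 * 2) hI4 (k₁ v) * zmodChar p hβ.pow_eq_one v) *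
        (∑ v : ZMod p, zmodChar (2 * 2) hI4 (-k₁ v) * zmodChar p hβ.pow_eq_one v) = 0 := by
  classical
  have hp : p.Prime := Fact.out
  haveI : NeZero p := ⟨hp.ne_zero⟩
  haveI : Fact (1 < p) := ⟨hp.one_lt⟩
  have hαα : Complex.I * Complex.I = -1 := by rw [← pow_two, Complex.I_sq]
  set ψ4 : AddChar (ZMod (2 * 2)) ℂ := zmodChar (2 * 2) hI4 with hψ4_def
  set ψp : AddChar (ZMod p) ℂ := zmodChar p hβ.pow_eq_one with hψp_def
  set a : ZMod (2 * 2) → ℤ := fun s => (if s = 0 then 1 else 0) - (if s = 2 then 1 else 0) with ha_def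
  set b : ZMod (2 * 2) → ℤ := fun s => (if s = 1 then 1 else 0) - (if s = 3 then 1 else 0) with hb_def
  have hcardA : ∀ (k : ZMod p → ZMod (2 * 2)) (d : ZMod p), ∑ v, a (k v - k (d - v)) =
      ((Finset.univ.filter fun v => k v - k (d - v) = 0).card : ℤ) -
        ((Finset.univ.filter fun v => k v - k (d - v) = 2).card : ℤ) := fun k d => by
    simp only [ha_def, Finset.sum_sub_distrib, Finset.sum_boole]
  have hcardB : ∀ (k : ZMod p → ZMod (2 * 2)) (d : ZMod p), ∑ v, b (k v - k (d - v)) =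
      ((Finset.univ.filter fun v => k v - k (d - v) = 1).card : ℤ) -
        ((Finset.univ.filter fun v => k v - k (d - v) = 3).card : ℤ) := fun k d => by
    simp only [hb_def, Finset.sum_sub_distrib, Finset.sum_boole]
  have hcoef : ∀ d : ZMod p, (∑ v : ZMod p, ψ4 (k₀ v - k₀ (d - v))) + (∑ v : ZMod p, ψ4 (k₁ v - k₁ (d - v))) =
      (((∑ v, a (k₀ v - k₀ (d - v))) + ∑ v, a (k₁ v - k₁ (d - v)) : ℤ) : ℂ) +
        (((∑ v, b (k₀ v - k₀ (d - v))) + ∑ v, b (k₁ v - k₁ (d - v)) : ℤ) : ℂ) * Complex.I := fun d => by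
    rw [hψ4_def, sum_psi_eq_coord _ hαα (fun v => k₀ v - k₀ (d - v)), sum_psi_eq_coord _ hαα (fun v => k₁ v - k₁ (d - v))]
    simp only [ha_def, hb_def, Int.cast_add]
    ring
  have hconst : ∀ d : ZMod p, (∑ v : ZMod p, ψ4 (k₀ v - k₀ (d - v))) + (∑ v : ZMod p, ψ4 (k₁ v - k₁ (d - v))) =
      (∑ v : ZMod p, ψ4 (k₀ v - k₀ (0 - v))) + (∑ v : ZMod p, ψ4 (k₁ v - k₁ (0 - v))) := fun d => by
    rw [hcoef, hcoef]
    have hRd := hR d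
    have hId := hI d
    have e1 : (∑ v, a (k₀ v - k₀ (d - v))) + ∑ v, a (k₁ v - k₁ (d - v)) =
        (∑ v, a (k₀ v - k₀ (0 - v))) + ∑ v, a (k₁ v - k₁ (0 - v)) := by
      simp only [hcardA]; omega
    have e2 : (∑ v, b (k₀ v - k₀ (d - v))) + ∑ v, b (k₁ v - k₁ (d - v)) =
        (∑ v, b (k₀ v - k₀ (0 - v))) + ∑ v, b (k₁ v - k₁ (0 - v)) := by
      simp only [hcardB]; omega
    rw [e1, e2]
  have hψp1 : ψp ≠ 1 := by
    intro h
    have h1 : ψp 1 = 1 := by rw [h, AddChar.one_apply]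
    rw [hψp_def, zmodChar_apply, ZMod.val_one, pow_one] at h1
    exact hβ.ne_one hp.one_lt h1
  rw [sheet_mul_sheet_tau, sheet_mul_sheet_tau, ← Finset.sum_add_distrib]
  have e3 : ∀ d : ZMod p, (∑ v : ZMod p, ψ4 (k₀ v - k₀ (d - v))) * ψp d + (∑ v : ZMod p, ψ4 (k₁ v - k₁ (d - v))) * ψp d =
      ((∑ v : ZMod p, ψ4 (k₀ v - k₀ (0 - v))) + (∑ v : ZMod p, ψ4 (k₁ v - k₁ (0 - v)))) * ψp d := fun d => by
    rw [← hconst d]; ring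
  simp_rw [e3]
  rw [← Finset.mul_sum, AddChar.sum_eq_zero_of_ne_one hψp1, mul_zero]

/-- **NO `μ₄`-NORM PAIR OF `Q₈ × C_p` WHEN `ord_p 2` IS ODD — the purely combinatorial statement** (no CM field in the
hypotheses): every pair `k₀, k₁ : ℤ/p → ℤ/4` satisfying the two balance identities of part II has `k₀` constant.  Proof: the
norm identity at `ζ = e^{2πi/p}` (previous theorem), part III's obstruction «`−1` is not a sum of two squares in `ℚ(ζ_p)` when
`ord_p 2` is odd» (`exists_subfield_of_odd_orderOf_two`) via part I's `sums_eq_zero_of_det_eq_zero`, so `G₀(ζ) = 0`, and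
`const_of_sheet_sum_eq_zero`.  Hence **`Q₈ × C_p` is GOOD for `ord_p 2` odd BECAUSE no norm pair exists, and for every
other `p` it is GOOD iff no norm pair exists.** [cite: Kubota1965, §4 Lemma 2] [cite: FeinGordonSmith1971, pp. 310–315]
[cite: Washington1997, Thm. 2.5] -/
theorem forall_normPair_const_of_odd_orderOf_two' (hodd : Odd (orderOf (2 : ZMod p))) (k₀ k₁ : ZMod p → ZMod 4)
    (hR : ∀ d : ZMod p,
      (Finset.univ.filter fun v => k₀ v - k₀ (d - v) = 0).card +
            (Finset.univ.filter fun v => k₁ v - k₁ (d - v) = 0).card +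
          (Finset.univ.filter fun v => k₀ v - k₀ (0 - v) = 2).card + (Finset.univ.filter fun v => k₁ v - k₁ (0 - v) = 2).card =
        (Finset.univ.filter fun v => k₀ v - k₀ (0 - v) = 0).card + (Finset.univ.filter fun v => k₁ v - k₁ (0 - v) = 0).card +
            (Finset.univ.filter fun v => k₀ v - k₀ (d - v) = 2).card +
          (Finset.univ.filter fun v => k₁ v - k₁ (d - v) = 2).card)
    (hI : ∀ d : ZMod p,
      (Finset.univ.filter fun v => k₀ v - k₀ (d - v) = 1).card +
            (Finset.univ.filter fun v => k₁ v - k₁ (d - v) = 1).card +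
          (Finset.univ.filter fun v => k₀ v - k₀ (0 - v) = 3).card + (Finset.univ.filter fun v => k₁ v - k₁ (0 - v) = 3).card =
        (Finset.univ.filter fun v => k₀ v - k₀ (0 - v) = 1).card + (Finset.univ.filter fun v => k₁ v - k₁ (0 - v) = 1).card +
            (Finset.univ.filter fun v => k₀ v - k₀ (d - v) = 3).card +
          (Finset.univ.filter fun v => k₁ v - k₁ (d - v) = 3).card) :
    ∀ v, k₀ v = k₀ 0 := by
  classical
  have hp : p.Prime := Fact.out
  haveI : NeZero p := ⟨hp.ne_zero⟩
  have hp2 : p ≠ 2 := ne_two_of_odd_orderOf_two hodd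
  have hε : (1 : ℤ) = 1 ∨ (1 : ℤ) = -1 := Or.inl rfl
  have hα : Complex.I = ((1 : ℤ) : ℂ) * Complex.I := by push_cast; ring
  have hI4 : Complex.I ^ (2 * 2) = 1 := alpha_pow_four hε hα
  have hζ : IsPrimitiveRoot (Complex.exp (2 * Real.pi * Complex.I / p)) p := Complex.isPrimitiveRoot_exp p hp.ne_zero
  set ψ4 : AddChar (ZMod (2 * 2)) ℂ := zmodChar (2 * 2) hI4 with hψ4_def
  set ψp : AddChar (ZMod p) ℂ := zmodChar p hζ.pow_eq_one with hψp_def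
  have hdet := det_eq_zero_of_normPair hI4 k₀ k₁ hζ hR hI
  let χ₀ : AddChar (Additive (Multiplicative (ZMod (2 * 2)) × Multiplicative (ZMod p))) ℂ :=
    { toFun := fun w => ψ4 (toAdd (Additive.toMul w).1) * ψp (toAdd (Additive.toMul w).2)
      map_zero_eq_one' := by simp
      map_add_eq_mul' := fun w w' => by
        simp only [toMul_add, Prod.fst_mul, Prod.snd_mul, toAdd_mul, map_add_eq_mul]; ring }
  have hχ₀ : ∀ (t : Multiplicative (ZMod (2 * 2))) (x : Multiplicative (ZMod p)),
      χ₀ (Additive.ofMul (t, x)) = ψ4 (toAdd t) * ψp (toAdd x) := fun t x => rfl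
  have h2val : (2 : ZMod (2 * 2)).val = 2 := by decide
  have hχc : χ₀ (Additive.ofMul (ofAdd (2 : ZMod (2 * 2)), (1 : Multiplicative (ZMod p)))) = -1 := by
    rw [hχ₀, toAdd_ofAdd, toAdd_one, map_zero_eq_one, mul_one, hψ4_def, zmodChar_apply, h2val, Complex.I_sq]
  set gr : (ZMod p → ZMod (2 * 2)) → Finset (Multiplicative (ZMod (2 * 2)) × Multiplicative (ZMod p)) := fun k =>
    Finset.univ.map ⟨fun v => (ofAdd (k v), ofAdd v), fun v w h => by simpa using congrArg Prod.snd h⟩ with hgr_def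
  have hgr_sum : ∀ (k : ZMod p → ZMod (2 * 2)) (g : Multiplicative (ZMod (2 * 2)) × Multiplicative (ZMod p) → ℂ),
      ∑ w ∈ gr k, g w = ∑ v : ZMod p, g (ofAdd (k v), ofAdd v) := fun k g => by
    rw [hgr_def, Finset.sum_map]; rfl
  have eS : ∀ k : ZMod p → ZMod (2 * 2), ∑ s ∈ gr k, χ₀ (Additive.ofMul s) = ∑ v : ZMod p, ψ4 (k v) * ψp v := fun k => by
    rw [hgr_sum]; exact Finset.sum_congr rfl fun v _ => by rw [hχ₀, toAdd_ofAdd, toAdd_ofAdd]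
  have eSθ : ∀ k : ZMod p → ZMod (2 * 2), ∑ s ∈ gr k, χ₀ (Additive.ofMul (s.1⁻¹, s.2)) =
      ∑ v : ZMod p, ψ4 (-k v) * ψp v := fun k => by
    rw [hgr_sum]; exact Finset.sum_congr rfl fun v _ => by rw [hχ₀, toAdd_inv, toAdd_ofAdd, toAdd_ofAdd]
  have hΔ : (∑ s ∈ gr k₀, χ₀ (Additive.ofMul s)) * (∑ s ∈ gr k₀, χ₀ (Additive.ofMul (s.1⁻¹, s.2))) +
      (∑ t ∈ gr k₁, χ₀ (Additive.ofMul t)) * (∑ t ∈ gr k₁, χ₀ (Additive.ofMul (t.1⁻¹, t.2))) = 0 := by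
    rw [eS, eSθ, eS, eSθ]
    exact hdet
  obtain ⟨E, hEμ, hE⟩ := exists_subfield_of_odd_orderOf_two hp hodd
  obtain ⟨hA₀, -⟩ := sums_eq_zero_of_det_eq_zero χ₀ hχc E hEμ hE (gr k₀) (gr k₁) hΔ
  rw [eS] at hA₀
  exact const_of_sheet_sum_eq_zero hp2 hε hα hζ k₀ hA₀

end Arithmetic

end Summit.HodgeConjecture.CorCM.GaloisQuaternionCyclic

end
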